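import Literature.AnabelianGeometry.SemiGraphs.BranchActionOnFibre
import Literature.AnabelianGeometry.SemiGraphs.CoveringOfObject
import Literature.AnabelianGeometry.Anabelioids.ComponentsOrbits

/-!
# Level edges of the covering attached to an object of `B(𝒢)`: the double-coset dictionary in `Π_𝒢`-coordinates ([SemiAnbd] §2)

Mochizuki, *Semi-graphs of anabelioids*, Publ. RIMS **42** (2006), §2, Definition 2.2 (i) p. 23
("the vertices (respectively, edges) of `𝔾′` that lie over a vertex `v` (respectively, edge `e`)
correspond to connected components of `S_v` (respectively, `T_e`)") and Remark 2.2.1 p. 24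
(decomposition groups as stabilisers) [cite: MochizukiSemiAnbd2006, Def. 2.2(i) p.23].

Proof-only bookkeeping (cell abc-iut, layer L3, row F-1477 / [SemiAnbd] Rmk. 2.10.1, sub-node (L4)
"level edges" of `LevelEdgeSeparation`, seat abc-iut-L6-t18; holder/assembler abc-iut-L3-t12) for the
CONCRETE covering `𝒢_X := X.coveringGraph` of abc-iut-L3-t5's `CoveringOfObject.lean`, in the frame
of abc-iut-L3-t12's `BranchActionOnFibre.lean`: an object `X ∈ B(𝒢)`, a basepoint `F` of `𝒢_v`, a
branch `b ∋ v` of the edge `e`, a basepoint `F_e` of `𝒢_e` and a transport `α : b^* ⋙ F_e ≅ F`.  A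
point `x ∈ F(S_v) = (ρ_v ⋙ F)(X)` determines the point `y(x) := F_e(ψ_b)(α⁻¹ x) ∈ F_e(T_e)`, hence
(components ↔ orbits, `ComponentsOrbits.lean`) the LEVEL EDGE `(e, Q)` of `𝒢_X` through `x` — the
connected component `Q` of `T_e` whose fibre contains `y(x)` — and the LEVEL VERTEX `(v, P)` through
`x`.

* `eComp_eq_iff_mem_orbit_branchSubgroup` — two points give the same level edge iff they lie in one
  orbit of the branch group `Π_b^{F_e, α} ⊆ Π_v`;
* `eComp_eq_iff_mem_map_mul_stabilizer` — in `Π_𝒢 = Aut(ρ_v ⋙ F)`: the level edges through `x₀` and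
  through `g · x₀` coincide iff `g ∈ Π_b · Stab(x₀)`; for the Galois object `A_V` (all stabilisers
  `= V`, abc-iut-L3-t12's `exists_bObj_stabilizer_eq`) this reads "edge(`b̃_g`) = edge(`b̃_1`) iff
  `g ∈ Π_b · V = V · Π_b`", i.e. the level edges over `e` (on the `b`-side) are the double cosets
  `Π_b \ Π_𝒢 / V`;
* `componentOver_eq_of_mem` — the `b`-end of the level edge through `x` is the level vertex through `x`;
* `coveringGraph_abuts_mk`, `coveringGraph_edge_mk_eq_iff` — the incidence of `𝒢_X` on the nose.

No statement here takes a side on any disputed claim; nothing about [IUTchIII] Cor. 3.12.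
-/

namespace Literature.AnabelianGeometry.SemiGraphs

open CategoryTheory CategoryTheory.PreGaloisCategory
open Literature.AnabelianGeometry.Anabelioids
open scoped Pointwise

universe v₁ u₁ u

namespace SemiGraphOfAnabelioids

variable {𝒢 : SemiGraphOfAnabelioids.{v₁, u₁, u}} (X : 𝒢.BObj) {v : 𝒢.graph.Vertex}
  (F : 𝒢.V v ⥤ FintypeCat.{v₁}) [FiberFunctor F] (b : 𝒢.graph.Branch) (h : 𝒢.graph.abuts b = some v)
  (Fe : 𝒢.E (𝒢.graph.edgeOf b) ⥤ FintypeCat.{v₁}) [FiberFunctor Fe]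
  (α : (𝒢.pull b v h).pullback ⋙ Fe ≅ F)

/-! ### Fibre images of subobjects (generic bookkeeping) -/

section Subobjects

variable {C : Type u₁} [Category.{v₁} C] (G : C ⥤ FintypeCat.{v₁})

omit [FiberFunctor F] [FiberFunctor Fe] in
/-- The fibre image of a smaller subobject is contained in that of a larger one. [folklore] -/
private theorem range_map_arrow_mono {Y : C} {P P' : Subobject Y} (hle : P ≤ P') :
    Set.range (G.map P.arrow) ⊆ Set.range (G.map P'.arrow) := by
  rintro _ ⟨p, rfl⟩
  refine ⟨G.map (Subobject.ofLE P P' hle) p, ?_⟩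
  rw [← FintypeCat.comp_apply, ← G.map_comp, Subobject.ofLE_arrow]

omit [FiberFunctor F] [FiberFunctor Fe] in
/-- The fibre image of the subobject `mk f` is the image of `G(f)`. [folklore] -/
private theorem range_map_mk_arrow {Y Z : C} (f : Z ⟶ Y) [Mono f] :
    Set.range (G.map (Subobject.mk f).arrow) = Set.range (G.map f) := by
  ext y
  constructor
  · rintro ⟨p, rfl⟩
    refine ⟨G.map (Subobject.underlyingIso f).hom p, ?_⟩
    rw [← FintypeCat.comp_apply, ← G.map_comp, Subobject.underlyingIso_hom_comp_eq_mk]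
  · rintro ⟨z, rfl⟩
    refine ⟨G.map (Subobject.underlyingIso f).inv z, ?_⟩
    rw [← FintypeCat.comp_apply, ← G.map_comp, Subobject.underlyingIso_arrow]

end Subobjects

/-! ### The comparison `x ↦ y(x) = F_e(ψ_b)(α⁻¹ x)` -/

omit [FiberFunctor F] [FiberFunctor Fe] in
/-- `α ∘ α⁻¹ = id` on points of the vertex fibre. [folklore] -/
private theorem hom_app_inv_app (S : 𝒢.V v) (x : F.obj S) : α.hom.app S (α.inv.app S x) = x := by
  rw [← FintypeCat.comp_apply (α.inv.app S) (α.hom.app S), ← NatTrans.comp_app, α.inv_hom_id,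
    NatTrans.id_app, FintypeCat.id_apply]

omit [FiberFunctor F] [FiberFunctor Fe] in
/-- The comparison `x ↦ F_e(ψ_b)(α⁻¹ x)` is injective. [folklore] -/
private theorem map_ψ_inv_app_injective :
    Function.Injective fun x : F.obj (X.S v) => Fe.map (X.ψ b v h).hom (α.inv.app (X.S v) x) := by
  intro x x' hxx'
  have h1 : Function.Injective (Fe.map (X.ψ b v h).hom) :=
    ((Fe ⋙ FintypeCat.incl).mapIso (X.ψ b v h)).toEquiv.injective
  have h2 := h1 hxx'
  have := congrArg (α.hom.app (X.S v)) h2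
  rwa [hom_app_inv_app, hom_app_inv_app] at this

/-! ### Level edges: components of `T_e` through `y(x)` -/

omit [FiberFunctor F] in
/-- Every point `x` of the vertex fibre determines a level edge: a (unique, below) connected component
`Q` of `T_e` whose fibre contains `y(x)`. [cite: MochizukiSemiAnbd2006, Def. 2.2(i) p.23] -/
theorem exists_eComp_mem (x : F.obj (X.S v)) :
    ∃ Q : π₀Obj (X.T (𝒢.graph.edgeOf b)),
      Fe.map (X.ψ b v h).hom (α.inv.app (X.S v) x) ∈ Set.range (Fe.map Q.1.arrow) :=
  exists_component_mem_range Fe _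

omit [FiberFunctor F] in
/-- … and that component is unique. [cite: MochizukiSemiAnbd2006, Def. 2.2(i) p.23] -/
theorem eComp_unique {x : F.obj (X.S v)} {Q Q' : π₀Obj (X.T (𝒢.graph.edgeOf b))}
    (hQ : Fe.map (X.ψ b v h).hom (α.inv.app (X.S v) x) ∈ Set.range (Fe.map Q.1.arrow))
    (hQ' : Fe.map (X.ψ b v h).hom (α.inv.app (X.S v) x) ∈ Set.range (Fe.map Q'.1.arrow)) :
    Q = Q' :=
  component_eq_of_mem_range Fe Q Q' hQ hQ'

omit [FiberFunctor F] in
/-- **Two points give the same level edge iff they lie in one `Π_b`-orbit.**  For `x, x' ∈ F(S_v)` with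
level edges `Q ∋ y(x)`, `Q' ∋ y(x')`: `Q = Q'` iff `x'` lies in the orbit of `x` under the branch group
`Π_b^{F_e, α} ⊆ Π_v = Aut F` (components of `T_e` ↔ `Π_e`-orbits of `F_e(T_e)`, and `y` intertwines
the `Π_e`-action with the branch action, `map_ψ_branch_smul`). [cite: MochizukiSemiAnbd2006, Rem. 2.2.1 p.24] -/
theorem eComp_eq_iff_mem_orbit_branchSubgroup {x x' : F.obj (X.S v)}
    {Q Q' : π₀Obj (X.T (𝒢.graph.edgeOf b))}
    (hQ : Fe.map (X.ψ b v h).hom (α.inv.app (X.S v) x) ∈ Set.range (Fe.map Q.1.arrow))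
    (hQ' : Fe.map (X.ψ b v h).hom (α.inv.app (X.S v) x') ∈ Set.range (Fe.map Q'.1.arrow)) :
    Q = Q' ↔ x' ∈ MulAction.orbit (𝒢.branchSubgroup F b h Fe α) x := by
  rw [component_eq_iff_range_eq Fe, range_map_arrow_eq_orbit Fe Q hQ,
    range_map_arrow_eq_orbit Fe Q' hQ', eq_comm, MulAction.orbit_eq_iff, MulAction.mem_orbit_iff,
    MulAction.mem_orbit_iff]
  constructor
  · rintro ⟨σ, hσ⟩
    refine ⟨⟨Aut.autMulEquivOfIso α (𝒢.piBToPiV b v h Fe σ), ⟨σ, rfl⟩⟩, ?_⟩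
    apply map_ψ_inv_app_injective X F b h Fe α
    change Fe.map (X.ψ b v h).hom
        (α.inv.app (X.S v) ((Aut.autMulEquivOfIso α (𝒢.piBToPiV b v h Fe σ)) • x)) = _
    rw [map_ψ_branch_smul, hσ]
  · rintro ⟨⟨p, σ, rfl⟩, hp⟩
    refine ⟨σ, ?_⟩
    rw [← map_ψ_branch_smul]
    change Fe.map (X.ψ b v h).hom (α.inv.app (X.S v)
      (((Aut.autMulEquivOfIso α).toMonoidHom.comp (𝒢.piBToPiV b v h Fe) σ) • x)) = _
    congr 2

omit [FiberFunctor F] in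
/-- **Level edges over `e` are the double cosets `Π_b \ Π_𝒢 / Stab(x₀)`.**  In `Π_𝒢 = Aut(ρ_v ⋙ F)`
acting on the fibre `(ρ_v ⋙ F)(X) = F(S_v)`: for `g ∈ Π_𝒢` and a point `x₀` with level edges
`Q₀ ∋ y(x₀)` and `Q ∋ y(g · x₀)`, `Q = Q₀` iff `g ∈ Π_b · Stab(x₀)` (with `Π_b ⊆ Π_𝒢` the image of the
branch group).  For abc-iut-L3-t12's Galois object `A_V` (`exists_bObj_stabilizer_eq`: every stabiliser
is the open normal `V`) this is "edge(`b̃_g`) = edge(`b̃_1`) iff `g ∈ Π_b · V = V · Π_b`".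
[cite: MochizukiSemiAnbd2006, Rem. 2.2.1 p.24] -/
theorem eComp_eq_iff_mem_map_mul_stabilizer (g : 𝒢.Pi v F) {x₀ : (𝒢.ρ v ⋙ F).obj X}
    {Q₀ Q : π₀Obj (X.T (𝒢.graph.edgeOf b))}
    (hQ₀ : Fe.map (X.ψ b v h).hom (α.inv.app (X.S v) x₀) ∈ Set.range (Fe.map Q₀.1.arrow))
    (hQ : Fe.map (X.ψ b v h).hom (α.inv.app (X.S v) (g • x₀)) ∈ Set.range (Fe.map Q.1.arrow)) :
    Q = Q₀ ↔
      g ∈ (((𝒢.branchSubgroup F b h Fe α).map (𝒢.piVToPi v F) : Subgroup (𝒢.Pi v F)) :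
          Set (𝒢.Pi v F)) * (MulAction.stabilizer (𝒢.Pi v F) x₀ : Set (𝒢.Pi v F)) := by
  rw [eq_comm, eComp_eq_iff_mem_orbit_branchSubgroup X F b h Fe α hQ₀ hQ, MulAction.mem_orbit_iff,
    Set.mem_mul]
  constructor
  · rintro ⟨⟨p, hp⟩, hpx⟩
    refine ⟨𝒢.piVToPi v F p, Subgroup.mem_map_of_mem _ hp, (𝒢.piVToPi v F p)⁻¹ * g, ?_,
      mul_inv_cancel_left _ _⟩
    rw [SetLike.mem_coe, MulAction.mem_stabilizer_iff, mul_smul, inv_smul_eq_iff, piVToPi_smul]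
    exact hpx.symm
  · rintro ⟨_, ⟨p, hp, rfl⟩, s, hs, rfl⟩
    refine ⟨⟨p, hp⟩, ?_⟩
    rw [SetLike.mem_coe, MulAction.mem_stabilizer_iff] at hs
    rw [mul_smul, hs]
    exact (piVToPi_smul X F p x₀).symm

/-! ### Level vertices: components of `S_v` through `x`, and the `b`-end of a level edge -/

omit [FiberFunctor Fe] in
/-- Every point `x ∈ F(S_v)` lies in the fibre of a unique connected component `P` of `S_v` — the level
vertex through `x`. [cite: MochizukiSemiAnbd2006, Def. 2.2(i) p.23] -/
theorem exists_vComp_mem (x : F.obj (X.S v)) :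
    ∃ P : π₀Obj (X.S v), x ∈ Set.range (F.map P.1.arrow) :=
  exists_component_mem_range F x

omit [FiberFunctor Fe] in
/-- Uniqueness of the level vertex through a point. [cite: MochizukiSemiAnbd2006, Def. 2.2(i) p.23] -/
theorem vComp_unique {x : F.obj (X.S v)} {P P' : π₀Obj (X.S v)}
    (hP : x ∈ Set.range (F.map P.1.arrow)) (hP' : x ∈ Set.range (F.map P'.1.arrow)) : P = P' :=
  component_eq_of_mem_range F P P' hP hP'

omit [FiberFunctor Fe] in
/-- **The `b`-end of the level edge through `x` is the level vertex through `x`**: if `Q ∋ y(x)` and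
`P ∋ x` then the component of `S_v` under `Q` along `b` (`componentOver`, the vertex of `𝒢_X` to which
the branch `(b, Q)` abuts) is `P`. [cite: MochizukiSemiAnbd2006, Def. 2.2(i) p.23] -/
theorem componentOver_eq_of_mem {x : F.obj (X.S v)} {Q : π₀Obj (X.T (𝒢.graph.edgeOf b))}
    {P : π₀Obj (X.S v)}
    (hQ : Fe.map (X.ψ b v h).hom (α.inv.app (X.S v) x) ∈ Set.range (Fe.map Q.1.arrow))
    (hP : x ∈ Set.range (F.map P.1.arrow)) : X.componentOver b v h Q = P := by
  -- `Q ⊆ ψ_b(b^* P')` for `P'` the component under `Q`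
  set P' := X.componentOver b v h Q
  have hle : Q.1 ≤ X.branchImage b v h P'.1 := X.le_branchImage_componentOver b v h Q
  -- hence `y(x)` lies in the fibre image of `ψ_b(b^* P')`, i.e. `α⁻¹ x ∈ F_e(b^* P')`
  have hy : Fe.map (X.ψ b v h).hom (α.inv.app (X.S v) x) ∈
      Set.range (Fe.map ((𝒢.pull b v h).pullback.map P'.1.arrow ≫ (X.ψ b v h).hom)) := by
    haveI := X.mono_map_arrow_comp_ψ b v h P'.1
    have := range_map_arrow_mono Fe hle hQ
    rwa [BObj.branchImage, range_map_mk_arrow Fe] at this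
  obtain ⟨z, hz⟩ := hy
  rw [Fe.map_comp, FintypeCat.comp_apply] at hz
  have hz' : Fe.map ((𝒢.pull b v h).pullback.map P'.1.arrow) z = α.inv.app (X.S v) x :=
    ((Fe ⋙ FintypeCat.incl).mapIso (X.ψ b v h)).toEquiv.injective hz
  -- transport along `α`: `x ∈ F(P')`
  have hx : x ∈ Set.range (F.map P'.1.arrow) := by
    refine ⟨α.hom.app _ z, ?_⟩
    have hnat := ConcreteCategory.congr_hom (α.hom.naturality P'.1.arrow) z
    simp only [Functor.comp_map, FintypeCat.comp_apply] at hnat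
    have h3 := congrArg (α.hom.app (X.S v)) hz'
    rw [hom_app_inv_app] at h3
    exact hnat.symm.trans h3
  exact vComp_unique X F hx hP

/-! ### The incidence of `𝒢_X` on the nose -/

/-- `Option.pbind` of a `some`-valued function at a `some`. [folklore] -/
private theorem pbind_some_of_eq {ι κ : Type*} {o : Option ι} {a : ι} (ho : o = some a)
    (f : ∀ x : ι, x ∈ o → κ) :
    (o.pbind fun x hx => some (f x hx)) = some (f a (Option.mem_def.mpr ho)) := by
  subst ho
  rfl

omit [FiberFunctor F] [FiberFunctor Fe] in
/-- The branch `(b, Q)` of `𝒢_X = X.coveringGraph` abuts to the vertex `(v, P)` with `P` the component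
of `S_v` under `Q` along `b`. [cite: MochizukiSemiAnbd2006, Def. 2.2(i) p.23] -/
theorem coveringGraph_abuts_mk (Q : π₀Obj (X.T (𝒢.graph.edgeOf b))) :
    X.coveringGraph.graph.abuts ⟨b, equivShrink _ Q⟩ =
      some ⟨v, equivShrink _ (X.componentOver b v h Q)⟩ := by
  have h1 : X.coveringGraph.graph.abuts ⟨b, equivShrink _ Q⟩ =
      (𝒢.graph.abuts b).pbind (fun w hw =>
        some (⟨w, X.fibreData.σ b w (Option.mem_def.mp hw) (equivShrink _ Q)⟩ :
          X.fibreData.total.Vertex)) := rfl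
  rw [h1, pbind_some_of_eq h]
  change some (⟨v, equivShrink _ (X.componentOver b v h ((equivShrink _).symm (equivShrink _ Q)))⟩ :
      X.fibreData.total.Vertex) = _
  rw [Equiv.symm_apply_apply]
  rfl

omit [FiberFunctor F] [FiberFunctor Fe] in
/-- The edge of the branch `(b, Q)` of `𝒢_X` is `(e(b), Q)`. [cite: MochizukiSemiAnbd2006, Def. 2.2(i) p.23] -/
theorem coveringGraph_edgeOf_mk (Q : π₀Obj (X.T (𝒢.graph.edgeOf b))) :
    X.coveringGraph.graph.edgeOf ⟨b, equivShrink _ Q⟩ = ⟨𝒢.graph.edgeOf b, equivShrink _ Q⟩ := rfl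

omit [FiberFunctor F] [FiberFunctor Fe] in
/-- Two level edges over the same edge `e` are equal iff their components are.
[cite: MochizukiSemiAnbd2006, Def. 2.2(i) p.23] -/
theorem coveringGraph_edge_mk_eq_iff {e : 𝒢.graph.Edge} (Q₁ Q₂ : π₀Obj (X.T e)) :
    (⟨e, equivShrink _ Q₁⟩ : X.coveringGraph.graph.Edge) = ⟨e, equivShrink _ Q₂⟩ ↔ Q₁ = Q₂ := by
  constructor
  · intro hq
    have := (Sigma.mk.inj_iff.mp hq).2
    exact (equivShrink _).injective (eq_of_heq this)
  · rintro rfl; rfl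

end SemiGraphOfAnabelioids

end Literature.AnabelianGeometry.SemiGraphs
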